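import Summits.ResolutionOfSingularities.ResolutionOfSingularities.Theorems.TameAbelianQuotientLU4
import Summits.ResolutionOfSingularities.ResolutionOfSingularities.Theorems.EigenLadderLU6
import HarnessLib

/-!
# TameAbelianQuotientLU (5/5) — single-column hygiene: off the eigen cell AND off the abelian cell

Part 5 of the g26 node `TameAbelianQuotientLU` of the ROOT/RESIDUAL decomposition cell
`decomp-res` (lens 1, window (W-ab) of critic row 193); see the module docstring of
`Summits.ResolutionOfSingularities.ResolutionOfSingularities.Theorems.TameAbelianQuotientLU` (part 1/5) for the thesis, the law,
the residual R26, the cuts and the sources.  Problem side, sorry-free, hypothesis-free.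

This part (0-weight hygiene): R26E `NonKHToricArchLUKeyHenselDescentEigenAbel` = R23 +
`¬ EigenLadderLU.TameEigenChartBelow k O` + `¬ TameAbelianEquivariantLUAbove k O`; the cuts
`nonKHToricArchLUKeyHenselDescentEigen_iff_eigenAbel : R24⁺ ↔ R26E` (hypothesis-free) and
`nonKHToricArchLUKeyHenselDescentAbel_iff_eigenAbel : TheoremDAll → (R26 ↔ R26E)`; `closes_eigenAbel`.
-/

noncomputable section

open IntermediateField Polynomial Literature.AlgebraicGeometry.Resolution IsLocalRing

namespace Summit.ResolutionOfSingularities.ResolutionOfSingularities.Theorems.TameAbelianQuotientLU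

/-! ## Part D — single-column hygiene (0-weight): the located residual off BOTH the tame
eigen cell of g24 (`EigenLadderLU.TameEigenChartBelow`, law modulo THEOREM D) AND the tame abelian
quotient cell (law hypothesis-free): `R24⁺ ↔ R26E` hypothesis-free, `R26 ↔ R26E` and
`R23 ↔ R26E` modulo `TheoremDAll`, ROOT BY NAME `closes_eigenAbel`. -/

section EigenAbelCut

open Summit.ResolutionOfSingularities.ResolutionOfSingularities.Theses
open Summit.ResolutionOfSingularities.ResolutionOfSingularities.Theorems
open Summit.ResolutionOfSingularities.ResolutionOfSingularities.Theorems.KeyChainLU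
open Summit.ResolutionOfSingularities.ResolutionOfSingularities.Theorems.HenselKeyChainLU
open Summit.ResolutionOfSingularities.ResolutionOfSingularities.Theorems.GaloisDescentLU
open Summit.ResolutionOfSingularities.ResolutionOfSingularities.Theorems.PfaffLine
open Summit.ResolutionOfSingularities.ResolutionOfSingularities.Theorems.ToricLadder
open Summit.ResolutionOfSingularities.ResolutionOfSingularities.Theorems.KaplanskyLadder
open Summit.ResolutionOfSingularities.ResolutionOfSingularities.Theorems.PerronLadder
open Summit.ResolutionOfSingularities.ResolutionOfSingularities.Theorems.DefectlessLadder
open Summit.ResolutionOfSingularities.ResolutionOfSingularities.Theorems.WCut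
open Summit.ResolutionOfSingularities.ResolutionOfSingularities.Theorems.TameQuotientLU
open Summit.ResolutionOfSingularities.ResolutionOfSingularities.Theorems.EigenLadderLU

/-- **SINGLE-COLUMN RESIDUAL R26E** (tag UNDECIDED · WEAKER than the root · located at
`(e, c, n) = (3, 3, 4)`): R23 off the tame EIGEN cell of g24 AND off the tame ABELIAN quotient
cell of g26 — the two tame eliminations of the descent column in ONE binder list. -/
def NonKHToricArchLUKeyHenselDescentEigenAbel (e c n : ℕ) : Prop :=
  ∀ p : ℕ, p.Prime → ∀ (k K : Type) [Field k] [CharP k p] [Field K] [Algebra k K],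
    Algebra.trdeg k K ≤ n → ∀ O : ValuationSubring K, Nonempty O.valuation.RankOne →
    (∀ y ∈ O, ∃ f : Polynomial k, f ≠ 0 ∧ Polynomial.aeval y f ∈ O.nonunits) →
    ¬ IsAbhyankarPlace O (algebraMap k K).fieldRange ⊤ →
    ¬ (∃ d : ℕ, d < n ∧ SepDenseBelow k O d) → ¬ ToricDenseBelow k O e → ¬ KHTopBelow k O c →
    ¬ KeyChainTopBelow k O → ¬ HenselKeyChainTopBelow k O → ¬ GaloisHenselDescentDatum k O →
    ¬ TameEigenChartBelow k O → ¬ TameAbelianEquivariantLUAbove k O → RelLocalUniformization k K O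

/-- `R26 ⇒ R26E` (drop the eigen binder; hypothesis-free). [folklore] -/
theorem nonKHToricArchLUKeyHenselDescentEigenAbel_of_abel {e c n : ℕ}
    (h : NonKHToricArchLUKeyHenselDescentAbel e c n) :
    NonKHToricArchLUKeyHenselDescentEigenAbel e c n :=
  fun p hp k K _ _ _ _ hd O h1 h0 hA hnd hnt hnk hkey hH hG _ hT =>
    h p hp k K hd O h1 h0 hA hnd hnt hnk hkey hH hG hT

/-- `R24⁺ ⇒ R26E` (drop the abelian binder; hypothesis-free). [folklore] -/
theorem nonKHToricArchLUKeyHenselDescentEigenAbel_of_eigen {e c n : ℕ}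
    (h : NonKHToricArchLUKeyHenselDescentEigen e c n) :
    NonKHToricArchLUKeyHenselDescentEigenAbel e c n :=
  fun p hp k K _ _ _ _ hd O h1 h0 hA hnd hnt hnk hkey hH hG hE _ =>
    h p hp k K hd O h1 h0 hA hnd hnt hnk hkey hH hG hE

/-- **The abelian cut of the g24 residual `R24⁺ ↔ R26E`** — EXACT and HYPOTHESIS-FREE (on the
difference the abelian law decides; no THEOREM D). [folklore] -/
theorem nonKHToricArchLUKeyHenselDescentEigen_iff_eigenAbel {e c n : ℕ} :
    NonKHToricArchLUKeyHenselDescentEigen e c n ↔ NonKHToricArchLUKeyHenselDescentEigenAbel e c n := by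
  refine ⟨nonKHToricArchLUKeyHenselDescentEigenAbel_of_eigen,
    fun h p hp k K _ _ _ _ hd O hr hz hA hnd hnt hnk hkey hH hG hE => ?_⟩
  by_cases hT : TameAbelianEquivariantLUAbove k O
  · exact relLU_of_tameAbelianEquivariantLUAbove hT
  · exact h p hp k K hd O hr hz hA hnd hnt hnk hkey hH hG hE hT

/-- **The eigen cut of R26 `R26 ↔ R26E`** — exact MODULO THEOREM D (the g24 eigen law
`EigenLadderLU.not_tameEigenChartBelow_of_not_datum` is mod D). [folklore] -/
theorem nonKHToricArchLUKeyHenselDescentAbel_iff_eigenAbel (hD : TheoremDAll) {e c n : ℕ} :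
    NonKHToricArchLUKeyHenselDescentAbel e c n ↔ NonKHToricArchLUKeyHenselDescentEigenAbel e c n := by
  refine ⟨nonKHToricArchLUKeyHenselDescentEigenAbel_of_abel,
    fun h p hp k K _ _ _ _ hd O hr hz hA hnd hnt hnk hkey hH hG hT => ?_⟩
  exact h p hp k K hd O hr hz hA hnd hnt hnk hkey hH hG
    (not_tameEigenChartBelow_of_not_datum (hD k) O hr hG) hT

/-- `R23 ↔ R26E` modulo THEOREM D. [folklore] -/
theorem nonKHToricArchLUKeyHenselDescent_iff_eigenAbel (hD : TheoremDAll) {e c n : ℕ} :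
    NonKHToricArchLUKeyHenselDescent e c n ↔ NonKHToricArchLUKeyHenselDescentEigenAbel e c n :=
  nonKHToricArchLUKeyHenselDescent_iff_abel.trans (nonKHToricArchLUKeyHenselDescentAbel_iff_eigenAbel hD)

/-- The single-column residual at `(3, 3, 4)`: `R24⁺ ↔ R26E` hypothesis-free. [folklore] -/
theorem nonKHToricArchLUKeyHenselDescentEigen334_iff_eigenAbel :
    NonKHToricArchLUKeyHenselDescentEigen 3 3 4 ↔ NonKHToricArchLUKeyHenselDescentEigenAbel 3 3 4 :=
  nonKHToricArchLUKeyHenselDescentEigen_iff_eigenAbel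

/-- R26E follows from the root outright (hypothesis-free). [folklore] -/
theorem nonKHToricArchLUKeyHenselDescentEigenAbel_of_root (hS : _root_.ResolutionOfSingularities)
    (e c n : ℕ) : NonKHToricArchLUKeyHenselDescentEigenAbel e c n :=
  nonKHToricArchLUKeyHenselDescentEigenAbel_of_abel (nonKHToricArchLUKeyHenselDescentAbel_of_root hS e c n)

/-- **`closes_eigenAbel` — ROOT BY NAME** from floor + CJS + Π₁ + THEOREM D + R26E (`d ≥ 4`) +
0642 (through the tree's `EigenLadderLU.closes_eigen` and the hypothesis-free abelian cut of
`R24⁺`). [folklore] -/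
theorem closes_eigenAbel (hCP : CossartPiltant2019LU3.{0}) (hCJS : CossartJannsenSaito2020Embedded.{0})
    (hAsc : KK05NCVAscent) (hD : TheoremDAll)
    (hN : ∀ d, 4 ≤ d → NonKHToricArchLUKeyHenselDescentEigenAbel 3 3 d)
    (h₃ : Valuative.PatchingRel) : _root_.ResolutionOfSingularities :=
  closes_eigen hCP hCJS hAsc hD
    (fun d hd => nonKHToricArchLUKeyHenselDescentEigen_iff_eigenAbel.2 (hN d hd)) h₃

/-- Root-level summary for R26E (modulo floor + CJS + Π₁ + D + 0642). [folklore] -/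
theorem root_iff_eigenAbel_sigma (hCP : CossartPiltant2019LU3.{0})
    (hCJS : CossartJannsenSaito2020Embedded.{0}) (hAsc : KK05NCVAscent) (hD : TheoremDAll)
    (h₃ : Valuative.PatchingRel) :
    _root_.ResolutionOfSingularities ↔ ∀ d, 4 ≤ d → NonKHToricArchLUKeyHenselDescentEigenAbel 3 3 d := by
  rw [root_iff_eigen_sigma hCP hCJS hAsc hD h₃]
  exact forall₂_congr fun d _ => nonKHToricArchLUKeyHenselDescentEigen_iff_eigenAbel

end EigenAbelCut

end Summit.ResolutionOfSingularities.ResolutionOfSingularities.Theorems.TameAbelianQuotientLU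

end
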